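import Mathlib
import Summits.Ventures.PercRepro2.TypedA3Inactive

/-!
# The spectator decomposition of row 2′TRI (blind cell PercRepro2, night-3 g3, 2026-08-24)

`TypedA3Inactive.lean` regroups every typed count by a spectator copy `x`:
`typedCount F z τ K = Σ_{x = z off F} pinnedCount G_x z_x (K x)`, and the complementary-pair
count only sees the `(y, w)`-symmetrised kernel `K x y w + K x w y`. For the kernel `K₃` of row
2′TRI that symmetrised kernel is an EXPLICIT combination of six two-copy kernels, with the
spectator entering only through `1_Q(x)`, `1_PD(x)` and `[1_PD 1_{o∈U}](x)`
(`K3_add_swap_eq_spectator`; `pd = 1_{a₃ ∉ U}`, `u_v = 1_{v ∈ U}`, `σ_v` the side sign,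
`Φ = σ_o − σ₃ u_o`, `Δf = f(y) − f(w)`, `sym f = f(y,w) + f(w,y)`):

  `K₃(x,y,w) + K₃(x,w,y) = 1_Q(x)·P1 + (1_Q(x) − 1_PD(x))·P2 + 1_PD(x)·(P3a + P3b + P4) + [1_PD 1_{o∈U}](x)·P5`,
  `P1 = sym{[pd u_o](y)·[1_Q σ₃ σ_b](w)}`, `P2 = sym{[pd u_b](y)·[pd u_o](w)}`,
  `P3a = 1_Q(y) 1_Q(w)·Δσ_b·Δσ_o`, `P3b = −1_Q(y) 1_Q(w)·Δσ_b·Δ(σ₃ u_o)`,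
  `P4 = −sym{1_Q(y)·[pd u_o u_b](w)} + sym{[pd u_o](y)·[pd u_b](w)}` (`= −Δ(pd u_o)·Δ(pd u_b)` on
  configurations), `P5 = −sym{[1_Q σ_b](y)·[1_Q σ₃](w)}`.

Hence (`typedCount_eq_spectator`) twice the typed count of `K₃` is the sum over the spectator
copies of these six complementary-pair counts on the spectator's minor, weighted by the
spectator's three indicators. With an inactive `a₃` only `P3a + P4` survives (the two cross
kernels, `TypedA3Inactive.lean`). Exact census of the SIGNED sub-sums on the abstract instances
with ≤ 3 typed edges (33,532 instances, `proofs/NIGHT3-CERT.md` §12.4): the sub-sums nonnegative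
on every instance are generated by `P2`, `P3a`, `P2 + P3a + P4`, `P1 + P5` and
`P1 + P3a + P3b + P5` — no partition of the six pieces into signed groups exists, so the weight
of `P3a` must depend on the spectator's state: the located three-copy content of row 2′TRI is
`P4` (the `−Cov_PD(u_o, u_b)` term) together with the `a₃`-pieces `P1`, `P3b`, `P5`.
Own code; standard axioms; no outside source.
-/

namespace Summit.Ventures.PercRepro2

open UnionCluster

namespace CovForm

namespace TypedA3

section Spectator

variable {V : Type*} {E : Type*} {R : Type*} [Field R]

/-- `P1 = sym{[pd u_o](y)·[1_Q σ₃ σ_b](w)}` (`f₃ ⊗ f₅`, symmetrised). -/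
noncomputable def P1 (ends : E → Sym2 V) (o a₁ a₂ a₃ b : V) (y w : Config E) : R :=
  f3 ends o a₁ a₂ a₃ y * f5 ends a₁ a₂ a₃ b w + f3 ends o a₁ a₂ a₃ w * f5 ends a₁ a₂ a₃ b y

/-- `P2 = sym{[pd u_b](y)·[pd u_o](w)}` (`f₁₂ ⊗ f₃`, symmetrised). -/
noncomputable def P2 (ends : E → Sym2 V) (o a₁ a₂ a₃ b : V) (y w : Config E) : R :=
  f12 ends a₁ a₂ a₃ b y * f3 ends o a₁ a₂ a₃ w + f12 ends a₁ a₂ a₃ b w * f3 ends o a₁ a₂ a₃ y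

/-- `P3a = 1_Q(y) 1_Q(w)·(σ_b(y) − σ_b(w))·(σ_o(y) − σ_o(w))`. -/
noncomputable def P3a (ends : E → Sym2 V) (o a₁ a₂ b : V) (y w : Config E) : R :=
  iQ ends a₁ a₂ y * iQ ends a₁ a₂ w *
    ((sigma ends a₁ a₂ b y - sigma ends a₁ a₂ b w) * (sigma ends a₁ a₂ o y - sigma ends a₁ a₂ o w))

/-- `P3b = −1_Q(y) 1_Q(w)·(σ_b(y) − σ_b(w))·([σ₃ u_o](y) − [σ₃ u_o](w))`. -/
noncomputable def P3b (ends : E → Sym2 V) (o a₁ a₂ a₃ b : V) (y w : Config E) : R :=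
  -(iQ ends a₁ a₂ y * iQ ends a₁ a₂ w *
    ((sigma ends a₁ a₂ b y - sigma ends a₁ a₂ b w) *
      (sigma ends a₁ a₂ a₃ y * inU ends a₁ a₂ o y - sigma ends a₁ a₂ a₃ w * inU ends a₁ a₂ o w)))

/-- `P4 = −sym{1_Q(y)·[pd u_o u_b](w)} + sym{[pd u_o](y)·[pd u_b](w)}`
(`= −(Δ[pd u_o])·(Δ[pd u_b])` on configurations). -/
noncomputable def P4 (ends : E → Sym2 V) (o a₁ a₂ a₃ b : V) (y w : Config E) : R :=
  -(iQ ends a₁ a₂ y * f11 ends o a₁ a₂ a₃ b w + iQ ends a₁ a₂ w * f11 ends o a₁ a₂ a₃ b y) +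
    (f3 ends o a₁ a₂ a₃ y * f12 ends a₁ a₂ a₃ b w + f3 ends o a₁ a₂ a₃ w * f12 ends a₁ a₂ a₃ b y)

/-- `P5 = −sym{[1_Q σ_b](y)·[1_Q σ₃](w)}` (`−f₇ ⊗ f₉`, symmetrised). -/
noncomputable def P5 (ends : E → Sym2 V) (a₁ a₂ a₃ b : V) (y w : Config E) : R :=
  -(f7 ends a₁ a₂ b y * f7 ends a₁ a₂ a₃ w + f7 ends a₁ a₂ b w * f7 ends a₁ a₂ a₃ y)

/-- **The spectator decomposition of the symmetrised kernel** — a polynomial identity in the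
twelve functions. -/
theorem K3_add_swap_eq_spectator (ends : E → Sym2 V) (o a₁ a₂ a₃ b : V) (x y w : Config E) :
    (K3 ends o a₁ a₂ a₃ b x y w : R) + K3 ends o a₁ a₂ a₃ b x w y =
      iQ ends a₁ a₂ x * P1 ends o a₁ a₂ a₃ b y w +
        (iQ ends a₁ a₂ x - iPD ends a₁ a₂ a₃ x) * P2 ends o a₁ a₂ a₃ b y w +
        iPD ends a₁ a₂ a₃ x *
          (P3a ends o a₁ a₂ b y w + P3b ends o a₁ a₂ a₃ b y w + P4 ends o a₁ a₂ a₃ b y w) +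
        f3 ends o a₁ a₂ a₃ x * P5 ends a₁ a₂ a₃ b y w := by
  unfold K3 sepKernel
  simp only [Fin.sum_univ_succ, Fin.sum_univ_zero, Matrix.cons_val_zero, Matrix.cons_val_succ,
    add_zero]
  unfold P1 P2 P3a P3b P4 P5 f3 f4 f5 f6 f7 f10 f11 f12
  ring

end Spectator

section SpectatorCount

variable {V : Type*} {E : Type*} [Fintype E] [DecidableEq E] {R : Type*} [Field R]

/-- **The spectator decomposition of row 2′TRI**: twice the typed count of `K₃` is the sum over
the spectator copies of the six complementary-pair counts on the spectator's minor, weighted by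
`1_Q(x)`, `1_Q(x) − 1_PD(x)`, `1_PD(x)` and `[1_PD 1_{o∈U}](x)`. -/
theorem typedCount_eq_spectator (ends : E → Sym2 V) (o a₁ a₂ a₃ b : V)
    (F : Finset E) (z : Config E) (τ : E → ℕ) (hτ : ∀ e ∈ F, τ e = 1 ∨ τ e = 2) :
    2 * typedCount F z τ (K3 ends o a₁ a₂ a₃ b : Config E → Config E → Config E → R) =
      ∑ x : Config E, if (∀ e, e ∉ F → x e = z e) then
        iQ ends a₁ a₂ x * pinnedCount (specFree F τ x) (specPin F z τ x) (P1 ends o a₁ a₂ a₃ b) +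
        (iQ ends a₁ a₂ x - iPD ends a₁ a₂ a₃ x) *
          pinnedCount (specFree F τ x) (specPin F z τ x) (P2 ends o a₁ a₂ a₃ b) +
        iPD ends a₁ a₂ a₃ x *
          (pinnedCount (specFree F τ x) (specPin F z τ x) (P3a ends o a₁ a₂ b) +
            pinnedCount (specFree F τ x) (specPin F z τ x) (P3b ends o a₁ a₂ a₃ b) +
            pinnedCount (specFree F τ x) (specPin F z τ x) (P4 ends o a₁ a₂ a₃ b)) +
        f3 ends o a₁ a₂ a₃ x * pinnedCount (specFree F τ x) (specPin F z τ x) (P5 ends a₁ a₂ a₃ b)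
      else 0 := by
  rw [typedCount_eq_sum_spec F z τ hτ, Finset.mul_sum]
  refine Finset.sum_congr rfl fun x _ => ?_
  split_ifs with hx
  · set G := specFree F τ x
    set zx := specPin F z τ x
    have hs := pinnedCount_swap G zx (K3 (R := R) ends o a₁ a₂ a₃ b x)
    calc (2 : R) * pinnedCount G zx (K3 (R := R) ends o a₁ a₂ a₃ b x)
        = pinnedCount G zx (K3 (R := R) ends o a₁ a₂ a₃ b x) +
            pinnedCount G zx (fun y w => K3 (R := R) ends o a₁ a₂ a₃ b x w y) := by
          rw [← hs]; ring
      _ = pinnedCount G zx (fun y w => K3 (R := R) ends o a₁ a₂ a₃ b x y w +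
            K3 (R := R) ends o a₁ a₂ a₃ b x w y) := by
          rw [pinnedCount_add]
      _ = pinnedCount G zx (fun y w =>
            iQ ends a₁ a₂ x * P1 ends o a₁ a₂ a₃ b y w +
            (iQ ends a₁ a₂ x - iPD ends a₁ a₂ a₃ x) * P2 ends o a₁ a₂ a₃ b y w +
            iPD ends a₁ a₂ a₃ x *
              (P3a ends o a₁ a₂ b y w + P3b ends o a₁ a₂ a₃ b y w + P4 ends o a₁ a₂ a₃ b y w) +
            f3 ends o a₁ a₂ a₃ x * P5 ends a₁ a₂ a₃ b y w) := by
          refine pinnedCount_congr _ _ _ _ fun y w => ?_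
          exact K3_add_swap_eq_spectator ends o a₁ a₂ a₃ b x y w
      _ = _ := by
          rw [pinnedCount_add, pinnedCount_add, pinnedCount_add, pinnedCount_const_mul,
            pinnedCount_const_mul, pinnedCount_const_mul, pinnedCount_const_mul,
            pinnedCount_add, pinnedCount_add]
  · simp

end SpectatorCount

/-! ## The covariance form: moving the spectator weight of `P1` by the copy symmetry -/

section Cov

variable {V : Type*} {E : Type*} [Fintype E] [DecidableEq E] {R : Type*} [Field R]

omit [Fintype E] [DecidableEq E] in
/-- The two-copy covariance kernel `1_Q(y) 1_Q(w)·(f(y) − f(w))·(g(y) − g(w))`. -/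
noncomputable def covKer (ends : E → Sym2 V) (a₁ a₂ : V) (f g : Config E → R) (y w : Config E) :
    R :=
  iQ ends a₁ a₂ y * iQ ends a₁ a₂ w * ((f y - f w) * (g y - g w))

omit [Fintype E] [DecidableEq E] in
/-- The typed-triple condition is symmetric in the first two copies. -/
lemma cond_swap12 (F : Finset E) (z : Config E) (τ : E → ℕ) (x y w : Config E) :
    ((∀ e, e ∉ F → x e = z e ∧ y e = z e ∧ w e = z e) ∧ (∀ e ∈ F, openCount x y w e = τ e)) ↔
      ((∀ e, e ∉ F → y e = z e ∧ x e = z e ∧ w e = z e) ∧ (∀ e ∈ F, openCount y x w e = τ e)) := by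
  simp only [openCount]
  constructor
  · rintro ⟨h1, h2⟩
    exact ⟨fun e he => ⟨(h1 e he).2.1, (h1 e he).1, (h1 e he).2.2⟩,
      fun e he => by rw [← h2 e he]; ring⟩
  · rintro ⟨h1, h2⟩
    exact ⟨fun e he => ⟨(h1 e he).2.1, (h1 e he).1, (h1 e he).2.2⟩,
      fun e he => by rw [← h2 e he]; ring⟩

/-- The typed count is invariant under swapping the first two copies of the kernel. -/
lemma typedCount_swap12 (F : Finset E) (z : Config E) (τ : E → ℕ)
    (K : Config E → Config E → Config E → R) :
    typedCount F z τ (fun x y w => K y x w) = typedCount F z τ K := by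
  unfold typedCount
  rw [Finset.sum_comm]
  refine Finset.sum_congr rfl fun y _ => Finset.sum_congr rfl fun x _ =>
    Finset.sum_congr rfl fun w _ => ?_
  exact if_congr (cond_swap12 F z τ x y w) rfl rfl

/-- The typed count is invariant under swapping the last two copies of the kernel (types in
`{1, 2}` on `F`): the complementary-pair count of each spectator is flip-symmetric. -/
lemma typedCount_swap23 (F : Finset E) (z : Config E) (τ : E → ℕ)
    (hτ : ∀ e ∈ F, τ e = 1 ∨ τ e = 2) (K : Config E → Config E → Config E → R) :
    typedCount F z τ (fun x y w => K x w y) = typedCount F z τ K := by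
  rw [typedCount_eq_sum_spec F z τ hτ, typedCount_eq_sum_spec F z τ hτ]
  refine Finset.sum_congr rfl fun x _ => ?_
  split_ifs
  · exact (pinnedCount_swap _ _ (K x)).symm
  · rfl

/-- The typed count is invariant under swapping the first and third copies of the kernel. -/
lemma typedCount_swap13 (F : Finset E) (z : Config E) (τ : E → ℕ)
    (hτ : ∀ e ∈ F, τ e = 1 ∨ τ e = 2) (K : Config E → Config E → Config E → R) :
    typedCount F z τ (fun x y w => K w y x) = typedCount F z τ K := by
  have e1 := typedCount_swap12 F z τ (fun x y w => K w x y)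
  have e2 := typedCount_swap23 F z τ hτ (fun x y w => K y x w)
  have e3 := typedCount_swap12 F z τ K
  exact e1.trans (e2.trans e3)

/-- The typed count is additive in the kernel. -/
lemma typedCount_add' (F : Finset E) (z : Config E) (τ : E → ℕ)
    (K K' : Config E → Config E → Config E → R) :
    typedCount F z τ (fun x y w => K x y w + K' x y w) =
      typedCount F z τ K + typedCount F z τ K' := by
  unfold typedCount
  simp only [← Finset.sum_add_distrib]
  refine Finset.sum_congr rfl fun x _ => Finset.sum_congr rfl fun y _ =>
    Finset.sum_congr rfl fun w _ => ?_
  split_ifs <;> simp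

/-- The typed count of the negated kernel. -/
lemma typedCount_neg' (F : Finset E) (z : Config E) (τ : E → ℕ)
    (K : Config E → Config E → Config E → R) :
    typedCount F z τ (fun x y w => -K x y w) = -typedCount F z τ K := by
  unfold typedCount
  simp only [← Finset.sum_neg_distrib]
  refine Finset.sum_congr rfl fun x _ => Finset.sum_congr rfl fun y _ =>
    Finset.sum_congr rfl fun w _ => ?_
  split_ifs <;> simp

/-- Pointwise equal kernels have equal typed counts. -/
lemma typedCount_congr' (F : Finset E) (z : Config E) (τ : E → ℕ)
    (K K' : Config E → Config E → Config E → R) (h : ∀ x y w, K x y w = K' x y w) :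
    typedCount F z τ K = typedCount F z τ K' := by
  have hK : K = K' := funext fun x => funext fun y => funext fun w => h x y w
  rw [hK]

end Cov

section CovTheorem

variable {V : Type*} {E : Type*} [Fintype E] [DecidableEq E] {R : Type*} [Field R]

/-- **The covariance form of row 2′TRI** (copy symmetry applied to the `P1` term): twice the
typed count of `K₃` is the typed count of the kernel
`pd(x)·Cov(σ_b, σ_o) + [pd u_o](x)·Cov(σ_b, σ₃) − pd(x)·Cov(σ_b, σ₃ u_o) + pd(x)·P4 + (1_Q − pd)(x)·P2`,
`Cov(f, g)(y, w) = 1_Q(y) 1_Q(w) (f(y) − f(w)) (g(y) − g(w))`. The first two covariances are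
sums of two-copy cross and same-side counts on the spectator's minor (row 2′TBHK territory); the
three-copy content of the row sits in the two NEGATIVE terms and their coupling with `P2`. -/
theorem typedCount_eq_cov (ends : E → Sym2 V) (o a₁ a₂ a₃ b : V)
    (F : Finset E) (z : Config E) (τ : E → ℕ) (hτ : ∀ e ∈ F, τ e = 1 ∨ τ e = 2) :
    2 * typedCount F z τ (K3 ends o a₁ a₂ a₃ b : Config E → Config E → Config E → R) =
      typedCount F z τ (fun x y w =>
        iPD ends a₁ a₂ a₃ x * covKer ends a₁ a₂ (sigma ends a₁ a₂ b) (sigma ends a₁ a₂ o) y w +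
        f3 ends o a₁ a₂ a₃ x * covKer ends a₁ a₂ (sigma ends a₁ a₂ b) (sigma ends a₁ a₂ a₃) y w -
        iPD ends a₁ a₂ a₃ x *
          covKer ends a₁ a₂ (sigma ends a₁ a₂ b)
            (fun ω => sigma ends a₁ a₂ a₃ ω * inU ends a₁ a₂ o ω) y w +
        iPD ends a₁ a₂ a₃ x * P4 ends o a₁ a₂ a₃ b y w +
        (iQ ends a₁ a₂ x - iPD ends a₁ a₂ a₃ x) * P2 ends o a₁ a₂ a₃ b y w) := by
  -- the two halves of the `P1` term, with the spectator weight moved by the copy symmetry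
  have e1 : typedCount F z τ (fun x y w => iQ (R := R) ends a₁ a₂ x *
        (f3 ends o a₁ a₂ a₃ y * f5 ends a₁ a₂ a₃ b w)) =
      typedCount F z τ (fun x y w => f3 (R := R) ends o a₁ a₂ a₃ x *
        (iQ ends a₁ a₂ y * f5 ends a₁ a₂ a₃ b w)) := by
    rw [← typedCount_swap12 F z τ (fun x y w => f3 (R := R) ends o a₁ a₂ a₃ x *
      (iQ ends a₁ a₂ y * f5 ends a₁ a₂ a₃ b w))]
    exact typedCount_congr' F z τ _ _ fun x y w => by ring
  have e2 : typedCount F z τ (fun x y w => iQ (R := R) ends a₁ a₂ x *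
        (f3 ends o a₁ a₂ a₃ w * f5 ends a₁ a₂ a₃ b y)) =
      typedCount F z τ (fun x y w => f3 (R := R) ends o a₁ a₂ a₃ x *
        (iQ ends a₁ a₂ w * f5 ends a₁ a₂ a₃ b y)) := by
    rw [← typedCount_swap13 F z τ hτ (fun x y w => f3 (R := R) ends o a₁ a₂ a₃ x *
      (iQ ends a₁ a₂ w * f5 ends a₁ a₂ a₃ b y))]
    exact typedCount_congr' F z τ _ _ fun x y w => by ring
  -- the rest of the spectator form
  set Rest : Config E → Config E → Config E → R := fun x y w =>
    (iQ ends a₁ a₂ x - iPD ends a₁ a₂ a₃ x) * P2 ends o a₁ a₂ a₃ b y w +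
      iPD ends a₁ a₂ a₃ x *
        (P3a ends o a₁ a₂ b y w + P3b ends o a₁ a₂ a₃ b y w + P4 ends o a₁ a₂ a₃ b y w) +
      f3 ends o a₁ a₂ a₃ x * P5 ends a₁ a₂ a₃ b y w with hRest
  calc 2 * typedCount F z τ (K3 (R := R) ends o a₁ a₂ a₃ b)
      = typedCount F z τ (K3 (R := R) ends o a₁ a₂ a₃ b) +
          typedCount F z τ (fun x y w => (K3 (R := R) ends o a₁ a₂ a₃ b x w y : R)) := by
        rw [typedCount_swap23 F z τ hτ (K3 (R := R) ends o a₁ a₂ a₃ b)]; ring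
    _ = typedCount F z τ (fun x y w => (K3 (R := R) ends o a₁ a₂ a₃ b x y w : R) +
          K3 ends o a₁ a₂ a₃ b x w y) := (typedCount_add' F z τ _ _).symm
    _ = typedCount F z τ (fun x y w =>
          iQ ends a₁ a₂ x * (f3 ends o a₁ a₂ a₃ y * f5 ends a₁ a₂ a₃ b w) +
          iQ ends a₁ a₂ x * (f3 ends o a₁ a₂ a₃ w * f5 ends a₁ a₂ a₃ b y) + Rest x y w) :=
        typedCount_congr' F z τ _ _ fun x y w => by
          rw [K3_add_swap_eq_spectator (R := R) ends o a₁ a₂ a₃ b x y w, hRest]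
          simp only [P1]; ring
    _ = typedCount F z τ (fun x y w => iQ (R := R) ends a₁ a₂ x *
            (f3 ends o a₁ a₂ a₃ y * f5 ends a₁ a₂ a₃ b w)) +
          typedCount F z τ (fun x y w => iQ (R := R) ends a₁ a₂ x *
            (f3 ends o a₁ a₂ a₃ w * f5 ends a₁ a₂ a₃ b y)) +
          typedCount F z τ Rest := by
        rw [← typedCount_add', ← typedCount_add']
    _ = typedCount F z τ (fun x y w => f3 (R := R) ends o a₁ a₂ a₃ x *
            (iQ ends a₁ a₂ y * f5 ends a₁ a₂ a₃ b w)) +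
          typedCount F z τ (fun x y w => f3 (R := R) ends o a₁ a₂ a₃ x *
            (iQ ends a₁ a₂ w * f5 ends a₁ a₂ a₃ b y)) +
          typedCount F z τ Rest := by
        rw [e1, e2]
    _ = typedCount F z τ (fun x y w =>
          f3 ends o a₁ a₂ a₃ x * (iQ ends a₁ a₂ y * f5 ends a₁ a₂ a₃ b w) +
          f3 ends o a₁ a₂ a₃ x * (iQ ends a₁ a₂ w * f5 ends a₁ a₂ a₃ b y) + Rest x y w) := by
        rw [← typedCount_add', ← typedCount_add']
    _ = _ :=
        typedCount_congr' F z τ _ _ fun x y w => by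
          rw [hRest]
          unfold covKer P3a P3b P5 f5 f7 f3
          ring

end CovTheorem

/-! ## The two good covariances are two-copy typed BHK statements -/

section TBHK

variable {V : Type*} {E : Type*} [Fintype E] [DecidableEq E] {R : Type*} [Field R]
  [LinearOrder R] [IsStrictOrderedRing R]

omit [Fintype E] [DecidableEq E] [LinearOrder R] [IsStrictOrderedRing R] in
/-- The same-side kernel `1_Q(y) 1_Q(w)·(1_{oL}(y) − 1_{oL}(w))·(1_{bL}(y) − 1_{bL}(w))` (BHK06
Thm 1.2 type: two marks on the side of `l`). -/
noncomputable def sameKernel (ends : E → Sym2 V) (l h o b : V) (y w : Config E) : R :=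
  ((connEvent ends l h)ᶜ).indicator 1 y * ((connEvent ends l h)ᶜ).indicator 1 w *
    (((connEvent ends l o).indicator 1 y - (connEvent ends l o).indicator 1 w) *
      ((connEvent ends l b).indicator 1 y - (connEvent ends l b).indicator 1 w))

/-- **The typed same-side statement** (the SAME form of row 2′TBHK, complementary-pair form): on
every minor the same-side count of two marks is nonnegative. -/
def SameCount (ends : E → Sym2 V) (l h o b : V) : Prop :=
  ∀ (G : Finset E) (z : Config E), 0 ≤ pinnedCount G z (sameKernel (R := R) ends l h o b)

omit [Fintype E] [DecidableEq E] [LinearOrder R] [IsStrictOrderedRing R] in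
/-- The covariance kernel of two side signs is the sum of the two cross kernels and the two
same-side kernels (one per root). -/
lemma covKer_sigma_eq (ends : E → Sym2 V) (a₁ a₂ u v : V) (y w : Config E) :
    covKer (R := R) ends a₁ a₂ (sigma ends a₁ a₂ u) (sigma ends a₁ a₂ v) y w =
      crossKernel ends a₁ a₂ v u y w + crossKernel ends a₁ a₂ u v y w +
        sameKernel ends a₁ a₂ u v y w + sameKernel ends a₂ a₁ u v y w := by
  unfold covKer crossKernel sameKernel sigma iQ iL iH
  rw [PendantRoot.avoidAll_eq_compl]
  have hc : ((connEvent ends a₂ a₁)ᶜ : Set (Config E)) = (connEvent ends a₁ a₂)ᶜ := by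
    rw [← PendantRoot.avoidAll_eq_compl, ← PendantRoot.avoidAll_eq_compl,
      A3Inactive.avoidAll_singleton_comm]
  rw [hc]
  ring

/-- **The covariance of two side signs is nonnegative on every minor** under the cross and
same-side typed BHK statements for the pair of marks. -/
theorem pinnedCount_covKer_nonneg (ends : E → Sym2 V) (a₁ a₂ u v : V)
    (hc₁ : CrossCount R ends a₁ a₂ v u) (hc₂ : CrossCount R ends a₁ a₂ u v)
    (hs₁ : SameCount (R := R) ends a₁ a₂ u v) (hs₂ : SameCount (R := R) ends a₂ a₁ u v)
    (G : Finset E) (z : Config E) :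
    0 ≤ pinnedCount G z (covKer (R := R) ends a₁ a₂ (sigma ends a₁ a₂ u) (sigma ends a₁ a₂ v)) := by
  rw [pinnedCount_congr G z _ _ (fun y w => covKer_sigma_eq (R := R) ends a₁ a₂ u v y w),
    pinnedCount_add, pinnedCount_add, pinnedCount_add]
  exact add_nonneg (add_nonneg (add_nonneg (hc₁ G z) (hc₂ G z)) (hs₁ G z)) (hs₂ G z)

end TBHK

/-! ## The row as a comparison of two nonnegative typed quantities -/

section Split

variable {V : Type*} {E : Type*} [Fintype E] [DecidableEq E] {R : Type*} [Field R]

omit [Fintype E] [DecidableEq E] in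
/-- The covariance kernel of the row: `pd(x)·Cov(σ_b,σ_o) + [pd u_o](x)·Cov(σ_b,σ₃) − pd(x)·Cov(σ_b,σ₃u_o)`
(the typed twin of `D·Cov_μ(σ_b, F)`). -/
noncomputable def covPart (ends : E → Sym2 V) (o a₁ a₂ a₃ b : V) (x y w : Config E) : R :=
  iPD ends a₁ a₂ a₃ x * covKer ends a₁ a₂ (sigma ends a₁ a₂ b) (sigma ends a₁ a₂ o) y w +
    f3 ends o a₁ a₂ a₃ x * covKer ends a₁ a₂ (sigma ends a₁ a₂ b) (sigma ends a₁ a₂ a₃) y w -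
    iPD ends a₁ a₂ a₃ x *
      covKer ends a₁ a₂ (sigma ends a₁ a₂ b) (fun ω => sigma ends a₁ a₂ a₃ ω * inU ends a₁ a₂ o ω) y w

omit [Fintype E] [DecidableEq E] in
/-- The `PD`-covariance kernel of the row: `−pd(x)·P4 − (1_Q − pd)(x)·P2` (the typed twin of
`D²·Cov_PD(1_{b∈U}, 1_{o∈U})`, with the sign that makes it nonnegative in every census). -/
noncomputable def pdPart (ends : E → Sym2 V) (o a₁ a₂ a₃ b : V) (x y w : Config E) : R :=
  -(iPD ends a₁ a₂ a₃ x * P4 ends o a₁ a₂ a₃ b y w) -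
    (iQ ends a₁ a₂ x - iPD ends a₁ a₂ a₃ x) * P2 ends o a₁ a₂ a₃ b y w

/-- **Row 2′TRI is the comparison of two typed quantities**: `2·N = T_cov − T_pd` with
`T_cov = typedCount covPart` and `T_pd = typedCount pdPart`. Exact census on the abstract instances
with ≤ 5 typed edges (4,792,568 instances, `NIGHT3-CERT.md` §12.11): `T_cov ≥ 0` and `T_pd ≥ 0` on
EVERY instance, so the row says that the typed covariance of `σ_b` with `F` dominates the typed
`PD`-covariance of `1_{b∈U}` and `1_{o∈U}` — the typed twin of (HCOV)'s
`P(Q)·Cov_μ(σ_b, F) ≥ D·Cov_PD(1_{b∈U}, 1_{o∈U})`. -/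
theorem typedCount_eq_covPart_sub_pdPart (ends : E → Sym2 V) (o a₁ a₂ a₃ b : V)
    (F : Finset E) (z : Config E) (τ : E → ℕ) (hτ : ∀ e ∈ F, τ e = 1 ∨ τ e = 2) :
    2 * typedCount F z τ (K3 ends o a₁ a₂ a₃ b : Config E → Config E → Config E → R) =
      typedCount F z τ (covPart (R := R) ends o a₁ a₂ a₃ b) -
        typedCount F z τ (pdPart (R := R) ends o a₁ a₂ a₃ b) := by
  rw [typedCount_eq_cov ends o a₁ a₂ a₃ b F z τ hτ, sub_eq_add_neg, ← typedCount_neg',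
    ← typedCount_add']
  refine typedCount_congr' F z τ _ _ fun x y w => ?_
  unfold covPart pdPart
  ring

end Split


end TypedA3

end CovForm

end Summit.Ventures.PercRepro2
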